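/-
Copyright (c) 2026 the pub-hodgecm-mathlib formalisation cell (harness21).  Prover seat hodgecm-mathlib-K2Liu-p10 (g3), Track B «K2-LIT»,
#184♮ = hLiu418 = `stmt-HodgeConjecture-24832`; Road Φ of socket #41, organ «Φ4-exact», method «E-det» — (HS) the ONE pure finite-field lemma for the
INERT value (K2Liu-p12 (g2) 10:48:24Z; twin of ★ `K2LiuResidueSingularMatrixCharacterSum`).  THEOREMS ONLY.
-/
import Summits.HodgeConjecture.HodgeConjecture.Theorems.K2LiuResidueSingularMatrixCharacterSum   -- ★ `sum_addChar_mul_left`, `sum_addChar_eq_neg_one`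
import Literature.NumberTheory.QuadraticForms.FiniteFieldDiagonalCount                          -- ★ `diagQuadCount_two` (binary diagonal forms over `𝔽_q`)
import HarnessLib

/-!
# Crux `HLiu418`, Road Φ, organ «Φ4-exact» (E-det): (HS) THE HERMITIAN SINGULAR CHARACTER SUM over a finite field

Cell `hodgecm-mathlib`, crux item hLiu418 = `stmt-HodgeConjecture-24832` (helper lane, count-neutral).  `k` a finite field, `d ∈ k` a NON-square
(so `char k ≠ 2` and `N(z) = z₁² − d z₂²` is the anisotropic norm form of `k(√d)`), `ψ ≠ 1` an additive character, `β = (p, u; ū, r)` a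
NON-SINGULAR hermitian matrix (`p r − N(u) ≠ 0`, `u = u₁ + u₂√d`).  In the coordinates `X = (a, z; z̄, b)` of hermitian `2 × 2` matrices,
`tr(βX) = p a + r b + 2 Re(u z̄) = p a + r b + 2(u₁z₁ − d u₂z₂)` and `det X = a b − N(z)`, and
  **`Σ_{X hermitian, det X = 0} ψ(tr(βX)) = +|k|`** (`sum_hermSingular_addChar`)
— versus `−|k|` for ALL singular matrices (the split case, ★ twin).  Proof: (1) the CONIC COUNT `#{N(z) = n} = q + 1` (`n ≠ 0`), `= 1` (`n = 0`)
(★ `diagQuadCount_two` with `η(d) = −1`); (2) for DIAGONAL `β` (`u = 0`): `Σ_{a,b} ψ(pa + rb)·#{N = ab} = (q+1)(Σψ)(Σψ) − q Σ_{ab=0} ψ(pa+rb) = q`;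
(3) REDUCTION to diagonal `β` by hermitian congruences `X ↦ gXg*` written as explicit bijections of `k⁴` preserving `det` (`g` unipotent for
`p ≠ 0`; the swap for `p = 0 ≠ r`; a shear first when `p = r = 0`).
Sources: [LidlNiederreiter1997, Ch. 6 §2 (Lemma 6.24)]; [KudlaRallis1994, §2]; [Shimura1997, §13].
HONEST LABEL.  Helper lemma, count-neutral; `HC_CM` is proved only modulo the 7 printed citations (2 remaining named inputs:
hLiu418 = `stmt-HodgeConjecture-24832`, h413 = `stmt-HodgeConjecture-24833`) until rung 0 closes.
-/

set_option autoImplicit false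
set_option linter.dupNamespace false -- the mandated namespace repeats `HodgeConjecture.HodgeConjecture`

noncomputable section

open Finset
open Literature.NumberTheory.QuadraticForms.FiniteFieldDiagonalCount
open Summit.HodgeConjecture.HodgeConjecture.Cruxes.HLiu418.K2LiuResidueSingularMatrixCharacterSum

namespace Summit.HodgeConjecture.HodgeConjecture.Cruxes.HLiu418.K2LiuResidueHermitianSingularCharacterSum

variable {k : Type*} [Field k] [Fintype k] [DecidableEq k] {ψ : AddChar k ℂ}

/-! ## 1. The conic count `#{z₁² − d z₂² = n}` -/

omit [Fintype k] [DecidableEq k] in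
/-- a non-square forces odd characteristic (in a finite field of characteristic `2` everything is a square). [cite: LidlNiederreiter1997, Ch. 6 §2] -/
theorem ringChar_ne_two_of_not_isSquare [Finite k] {d : k} (hd : ¬IsSquare d) : ringChar k ≠ 2 :=
  fun h => hd (FiniteField.isSquare_of_char_two h d)

/-- **THE CONIC COUNT**: for a non-square `d`, `Σ_{z₁,z₂} 𝟙[z₁² − d z₂² = n] = 1` if `n = 0` and `= q + 1` otherwise (★ `diagQuadCount_two` for the
diagonal form `⟨1, −d⟩`, `η(d) = −1`). [cite: LidlNiederreiter1997, Ch. 6 §2 (Lemma 6.24)] -/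
theorem sum_indicator_norm_eq {d : k} (hd : ¬IsSquare d) (n : k) :
    ∑ z₁ : k, ∑ z₂ : k, (if z₁ ^ 2 - d * z₂ ^ 2 = n then (1 : ℂ) else 0) =
      if n = 0 then 1 else (Fintype.card k : ℂ) + 1 := by
  have hF := ringChar_ne_two_of_not_isSquare hd
  have hd0 : d ≠ 0 := fun h => hd (h ▸ IsSquare.zero)
  -- the tree's count, as an integer
  have hcount := diagQuadCount_two hF (one_ne_zero (α := k)) (neg_ne_zero.2 hd0) n
  rw [show -((1 : k) * -d) = d by ring, quadraticChar_neg_one_iff_not_isSquare.2 hd, quadV_eq] at hcount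
  -- our double sum is that count
  have hsum : (∑ z₁ : k, ∑ z₂ : k, (if z₁ ^ 2 - d * z₂ ^ 2 = n then (1 : ℂ) else 0)) = (diagQuadCount ![(1 : k), -d] n : ℂ) := by
    rw [diagQuadCount, Fintype.card_subtype, Finset.card_filter, Nat.cast_sum, ← Fintype.sum_prod_type',
      ← (finTwoArrowEquiv k).sum_comp]
    refine Finset.sum_congr rfl fun x _ => ?_
    simp only [finTwoArrowEquiv_apply, Fin.sum_univ_two, Matrix.cons_val_zero, Matrix.cons_val_one, one_mul, neg_mul,
      ← sub_eq_add_neg, Nat.cast_ite, Nat.cast_one, Nat.cast_zero]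
    rfl
  rw [hsum, show (diagQuadCount ![(1 : k), -d] n : ℂ) = ((diagQuadCount ![(1 : k), -d] n : ℤ) : ℂ) by norm_cast, hcount]
  split_ifs <;> push_cast <;> ring

/-! ## 2. Four-fold sums: product form and re-indexing along a bijection of `k⁴` -/

omit [Field k] [DecidableEq k] in
/-- `Σ_{x ∈ k⁴} f(x) = Σ_a Σ_b Σ_{z₁} Σ_{z₂} f(a, b, z₁, z₂)`. [folklore] -/
theorem sum_prod_four (f : k × k × k × k → ℂ) : ∑ x, f x = ∑ a : k, ∑ b : k, ∑ z₁ : k, ∑ z₂ : k, f (a, b, z₁, z₂) := by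
  rw [Fintype.sum_prod_type]
  refine Finset.sum_congr rfl fun a _ => ?_
  rw [Fintype.sum_prod_type]
  refine Finset.sum_congr rfl fun b _ => ?_
  rw [Fintype.sum_prod_type]

omit [Field k] [DecidableEq k] in
/-- **re-indexing a four-fold sum along a bijection of `k⁴`** (given with its two-sided inverse): `Σ f = Σ g` if `f ∘ φ = g`. [folklore] -/
theorem sum_four_eq_of_bij (φ χ : k × k × k × k → k × k × k × k) (hφχ : ∀ x, φ (χ x) = x) (hχφ : ∀ x, χ (φ x) = x)
    (f g : k × k × k × k → ℂ) (h : ∀ x, f (φ x) = g x) :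
    ∑ a : k, ∑ b : k, ∑ z₁ : k, ∑ z₂ : k, f (a, b, z₁, z₂) = ∑ a : k, ∑ b : k, ∑ z₁ : k, ∑ z₂ : k, g (a, b, z₁, z₂) := by
  rw [← sum_prod_four f, ← sum_prod_four g, ← Equiv.sum_comp ⟨φ, χ, hχφ, hφχ⟩ f]
  exact Fintype.sum_congr _ _ h

/-- the hermitian character sum re-indexed along a `det`-preserving bijection of `k⁴` transporting the phase of `β = (p, u; ū, r)` to that of
`β′ = (p′, u′; ū′, r′)` (a hermitian congruence `X ↦ gXg*`, `β′ = g*βg`). [cite: KudlaRallis1994, §2] -/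
theorem sum_hermSingular_eq_of_bij (d : k) (φ χ : k × k × k × k → k × k × k × k) (hφχ : ∀ x, φ (χ x) = x) (hχφ : ∀ x, χ (φ x) = x)
    (p r u₁ u₂ p' r' u₁' u₂' : k)
    (hdet : ∀ x : k × k × k × k, (φ x).1 * (φ x).2.1 - ((φ x).2.2.1 ^ 2 - d * (φ x).2.2.2 ^ 2) = x.1 * x.2.1 - (x.2.2.1 ^ 2 - d * x.2.2.2 ^ 2))
    (hphase : ∀ x : k × k × k × k, p * (φ x).1 + r * (φ x).2.1 + 2 * (u₁ * (φ x).2.2.1 - d * u₂ * (φ x).2.2.2) =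
      p' * x.1 + r' * x.2.1 + 2 * (u₁' * x.2.2.1 - d * u₂' * x.2.2.2)) :
    ∑ a : k, ∑ b : k, ∑ z₁ : k, ∑ z₂ : k, (if a * b = z₁ ^ 2 - d * z₂ ^ 2 then ψ (p * a + r * b + 2 * (u₁ * z₁ - d * u₂ * z₂)) else 0) = ∑ a : k, ∑ b : k, ∑ z₁ : k, ∑ z₂ : k, (if a * b = z₁ ^ 2 - d * z₂ ^ 2 then ψ (p' * a + r' * b + 2 * (u₁' * z₁ - d * u₂' * z₂)) else 0) := by
  refine sum_four_eq_of_bij φ χ hφχ hχφ (fun x => if x.1 * x.2.1 = x.2.2.1 ^ 2 - d * x.2.2.2 ^ 2 then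
      ψ (p * x.1 + r * x.2.1 + 2 * (u₁ * x.2.2.1 - d * u₂ * x.2.2.2)) else 0)
    (fun x => if x.1 * x.2.1 = x.2.2.1 ^ 2 - d * x.2.2.2 ^ 2 then ψ (p' * x.1 + r' * x.2.1 + 2 * (u₁' * x.2.2.1 - d * u₂' * x.2.2.2)) else 0) fun x => ?_
  have hiff : (φ x).1 * (φ x).2.1 = (φ x).2.2.1 ^ 2 - d * (φ x).2.2.2 ^ 2 ↔ x.1 * x.2.1 = x.2.2.1 ^ 2 - d * x.2.2.2 ^ 2 := by
    rw [← sub_eq_zero, hdet, sub_eq_zero]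
  simp only [hiff, hphase]

/-! ## 3. Diagonal `β`: `Σ_{ab = N(z)} ψ(pa + rb) = q` -/

/-- **the diagonal case** (`u = 0`, `p r ≠ 0`): `Σ_{a,b} ψ(pa + rb)·#{N(z) = ab} = q` — `#{N = ab} = 1 + q·𝟙[ab ≠ 0]` and orthogonality.
[cite: KudlaRallis1994, §2] [cite: LidlNiederreiter1997, Ch. 6 §2] -/
theorem sum_hermSingular_addChar_diag (hψ : ψ ≠ 1) {d : k} (hd : ¬IsSquare d) {p r : k} (hp : p ≠ 0) (hr : r ≠ 0) :
    ∑ a : k, ∑ b : k, ∑ z₁ : k, ∑ z₂ : k, (if a * b = z₁ ^ 2 - d * z₂ ^ 2 then ψ (p * a + r * b + 2 * (0 * z₁ - d * 0 * z₂)) else 0) = (Fintype.card k : ℂ) := by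
  -- the conic count inside
  have hinner : ∀ a b : k, (∑ z₁ : k, ∑ z₂ : k, (if a * b = z₁ ^ 2 - d * z₂ ^ 2 then ψ (p * a + r * b + 2 * (0 * z₁ - d * 0 * z₂)) else 0)) =
      ψ (p * a) * ψ (r * b) * (if a * b = 0 then 1 else (Fintype.card k : ℂ) + 1) := by
    intro a b
    rw [← sum_indicator_norm_eq hd (a * b), Finset.mul_sum]
    refine Finset.sum_congr rfl fun z₁ _ => ?_
    rw [Finset.mul_sum]
    refine Finset.sum_congr rfl fun z₂ _ => ?_
    rw [zero_mul, mul_zero, zero_mul, sub_zero, mul_zero, add_zero, AddChar.map_add_eq_mul]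
    by_cases h : a * b = z₁ ^ 2 - d * z₂ ^ 2
    · rw [if_pos h, if_pos h.symm, mul_one]
    · rw [if_neg h, if_neg (Ne.symm h), mul_zero]
  simp_rw [hinner]
  -- the `b`-sum for fixed `a`
  have hrow : ∀ a : k, (∑ b : k, ψ (p * a) * ψ (r * b) * (if a * b = 0 then 1 else (Fintype.card k : ℂ) + 1)) =
      if a = 0 then 0 else -(ψ (p * a) * (Fintype.card k : ℂ)) := by
    intro a
    simp_rw [mul_assoc, ← Finset.mul_sum]
    by_cases ha : a = 0
    · rw [if_pos ha, ha]
      simp only [zero_mul, if_true, mul_one]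
      rw [sum_addChar_mul_left hψ r, if_neg hr, mul_zero]
    · rw [if_neg ha]
      have hb : ∀ b : k, (ψ (r * b) * if a * b = 0 then (1 : ℂ) else (Fintype.card k : ℂ) + 1) =
          ((Fintype.card k : ℂ) + 1) * ψ (r * b) - (Fintype.card k : ℂ) * (if b = 0 then ψ (r * b) else 0) := by
        intro b
        by_cases hb0 : b = 0
        · subst hb0
          simp only [mul_zero, if_true]; ring
        · rw [if_neg (mul_ne_zero ha hb0), if_neg hb0]; ring
      simp_rw [hb]
      rw [Finset.sum_sub_distrib, ← Finset.mul_sum, ← Finset.mul_sum, sum_addChar_mul_left hψ r, if_neg hr, mul_zero, zero_sub,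
        Finset.sum_ite_eq' univ (0 : k), if_pos (mem_univ _), mul_zero, AddChar.map_zero_eq_one, mul_one, mul_neg]
  simp_rw [hrow]
  -- the `a`-sum: `Σ_{a ≠ 0} ψ(pa) = −1`
  have hsplit : (∑ a : k, if a = 0 then (0 : ℂ) else -(ψ (p * a) * (Fintype.card k : ℂ))) =
      -(Fintype.card k : ℂ) * ((∑ a : k, ψ (p * a)) - 1) := by
    rw [← Finset.sum_erase_add _ _ (mem_univ (0 : k)), if_pos rfl, add_zero,
      ← Finset.sum_erase_add univ (fun a => ψ (p * a)) (mem_univ (0 : k)), mul_zero, AddChar.map_zero_eq_one, add_sub_cancel_right,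
      Finset.mul_sum]
    refine Finset.sum_congr rfl fun a ha => ?_
    rw [if_neg (Finset.ne_of_mem_erase ha)]; ring
  rw [hsplit, sum_addChar_mul_left hψ p, if_neg hp]; ring

/-! ## 4. Reduction to diagonal `β` by hermitian congruences -/

/-- **`p ≠ 0`**: the unipotent congruence `g = (1, −u∕p; 0, 1)` kills `u` (`β ↦ diag(p, r − N(u)∕p)`), so the sum is `q`.
[cite: KudlaRallis1994, §2] [cite: Shimura1997, §13] -/
theorem sum_hermSingular_addChar_of_ne_zero (hψ : ψ ≠ 1) {d : k} (hd : ¬IsSquare d) {p r u₁ u₂ : k} (hp : p ≠ 0)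
    (hβ : p * r - (u₁ ^ 2 - d * u₂ ^ 2) ≠ 0) :
    ∑ a : k, ∑ b : k, ∑ z₁ : k, ∑ z₂ : k, (if a * b = z₁ ^ 2 - d * z₂ ^ 2 then ψ (p * a + r * b + 2 * (u₁ * z₁ - d * u₂ * z₂)) else 0) = (Fintype.card k : ℂ) := by
  have hr' : r - (u₁ ^ 2 - d * u₂ ^ 2) / p ≠ 0 := by
    intro h
    apply hβ
    have : p * (r - (u₁ ^ 2 - d * u₂ ^ 2) / p) = 0 := by rw [h, mul_zero]
    rwa [mul_sub, mul_div_cancel₀ _ hp] at this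
  -- the congruence `X ↦ gXg*`, `g = (1, t; 0, 1)`, `t = −u∕p`, as a bijection of `k⁴` with inverse `t ↦ −t`
  rw [sum_hermSingular_eq_of_bij (ψ := ψ) d
    (fun x => (x.1 + 2 * ((-u₁ / p) * x.2.2.1 - d * (-u₂ / p) * x.2.2.2) + ((-u₁ / p) ^ 2 - d * (-u₂ / p) ^ 2) * x.2.1, x.2.1,
      x.2.2.1 + (-u₁ / p) * x.2.1, x.2.2.2 + (-u₂ / p) * x.2.1))
    (fun x => (x.1 + 2 * ((u₁ / p) * x.2.2.1 - d * (u₂ / p) * x.2.2.2) + ((u₁ / p) ^ 2 - d * (u₂ / p) ^ 2) * x.2.1, x.2.1,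
      x.2.2.1 + (u₁ / p) * x.2.1, x.2.2.2 + (u₂ / p) * x.2.1))
    (fun x => Prod.ext (by simp only; ring) (Prod.ext rfl (Prod.ext (by simp only; ring) (by simp only; ring))))
    (fun x => Prod.ext (by simp only; ring) (Prod.ext rfl (Prod.ext (by simp only; ring) (by simp only; ring))))
    p r u₁ u₂ p (r - (u₁ ^ 2 - d * u₂ ^ 2) / p) 0 0 (fun x => by simp only; ring) (fun x => by simp only; field_simp; ring)]
  exact sum_hermSingular_addChar_diag hψ hd hp hr'

/-! ## 5. The theorem -/

/-- **THE HERMITIAN SINGULAR CHARACTER SUM**: for a finite field `k`, a non-square `d`, `ψ ≠ 1`, and `β = (p, u; ū, r)` with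
`p r − N(u) ≠ 0`:  `Σ_{(a,b,z₁,z₂) ∈ k⁴, ab = z₁² − d z₂²} ψ(p a + r b + 2(u₁z₁ − d u₂z₂)) = |k|` — the Fourier transform of the singular HERMITIAN
`2 × 2` matrices over `k(√d)` at a non-singular hermitian point is `+|k|` (the inert sign of «E-det»). [cite: KudlaRallis1994, §2] [cite: Shimura1997, §13] -/
theorem sum_hermSingular_addChar (hψ : ψ ≠ 1) {d : k} (hd : ¬IsSquare d) (p r u₁ u₂ : k) (hβ : p * r - (u₁ ^ 2 - d * u₂ ^ 2) ≠ 0) :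
    ∑ a : k, ∑ b : k, ∑ z₁ : k, ∑ z₂ : k, (if a * b = z₁ ^ 2 - d * z₂ ^ 2 then ψ (p * a + r * b + 2 * (u₁ * z₁ - d * u₂ * z₂)) else 0) = (Fintype.card k : ℂ) := by
  have hF := ringChar_ne_two_of_not_isSquare hd
  have h2 : (2 : k) ≠ 0 := Ring.two_ne_zero hF
  by_cases hp : p = 0
  · by_cases hr : r = 0
    · -- `p = r = 0`: `N(u) ≠ 0`; the shear `g = (1, 0; ū, 1)` makes `p′ = 2 N(u) ≠ 0`
      subst hp; subst hr
      have hN : u₁ ^ 2 - d * u₂ ^ 2 ≠ 0 := by intro h; apply hβ; rw [h]; ring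
      rw [sum_hermSingular_eq_of_bij (ψ := ψ) d
        (fun x => (x.1, x.2.1 + (u₁ ^ 2 - d * u₂ ^ 2) * x.1 + 2 * (u₁ * x.2.2.1 - d * u₂ * x.2.2.2), x.2.2.1 + x.1 * u₁, x.2.2.2 + x.1 * u₂))
        (fun x => (x.1, x.2.1 + (u₁ ^ 2 - d * u₂ ^ 2) * x.1 - 2 * (u₁ * x.2.2.1 - d * u₂ * x.2.2.2), x.2.2.1 - x.1 * u₁, x.2.2.2 - x.1 * u₂))
        (fun x => Prod.ext rfl (Prod.ext (by simp only; ring) (Prod.ext (by simp only; ring) (by simp only; ring))))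
        (fun x => Prod.ext rfl (Prod.ext (by simp only; ring) (Prod.ext (by simp only; ring) (by simp only; ring))))
        0 0 u₁ u₂ (2 * (u₁ ^ 2 - d * u₂ ^ 2)) 0 u₁ u₂ (fun x => by simp only; ring) (fun x => by simp only; ring)]
      exact sum_hermSingular_addChar_of_ne_zero hψ hd (mul_ne_zero h2 hN) (by rw [mul_zero, zero_sub, neg_ne_zero]; exact hN)
    · -- `p = 0 ≠ r`: the swap `(a, b, z) ↦ (b, a, z̄)` exchanges `p` and `r`
      subst hp
      rw [sum_hermSingular_eq_of_bij (ψ := ψ) d (fun x => (x.2.1, x.1, x.2.2.1, -x.2.2.2)) (fun x => (x.2.1, x.1, x.2.2.1, -x.2.2.2))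
        (fun x => Prod.ext rfl (Prod.ext rfl (Prod.ext rfl (by simp only; ring))))
        (fun x => Prod.ext rfl (Prod.ext rfl (Prod.ext rfl (by simp only; ring))))
        0 r u₁ u₂ r 0 u₁ (-u₂) (fun x => by simp only; ring) (fun x => by simp only; ring)]
      exact sum_hermSingular_addChar_of_ne_zero hψ hd hr (by rw [mul_zero]; rw [zero_mul] at hβ; simpa [neg_mul, mul_neg] using hβ)
  · exact sum_hermSingular_addChar_of_ne_zero hψ hd hp hβ


end Summit.HodgeConjecture.HodgeConjecture.Cruxes.HLiu418.K2LiuResidueHermitianSingularCharacterSum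

end
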